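import Summits.QuantumFields.BalabanUV.T4Continuum.Support.NE3CornerGaugeSpace
import HarnessLib

/-!
# T⁴ programme, node NE3 — row E-MLw-(w4)-P, sub-row Φ6 at a CURVED background, file 1: THE CORNER-TRIVIAL GAUGE SPACE `Ξ₀(W)`,
# ITS GRAM FORM FOR `D_W`, AND THE PROJECTION STEP; ORTHOGONALITY TO `D_W Ξ₀` ⟺ COVARIANT DIVERGENCE ZERO OFF THE CORNERS

NE3 (node U1b) formalisation swarm `b2b-balaban-t4-ne3-formalise-*`, leaf seat `b2b-balaban-t4-ne3-formalise-leaf-01` (gen 5);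
continuation of this seat's flat Φ6-pt (`NE3ProjectedLandauProjection` p225015, `NE3ProjectedLandauRepr` p225823) to a CURVED
background `W` — the «chart L1 `ker d(avg^k)(W) = D_W Ξ₀ ⊕ T(W)`» of D-ne3p1-g21-2 §2 Φ6 ∕ ρ-g21-2 (V4) (`T(W) := ker d(avg^k)(W) ∩
{D_W^* Y = 0 off corners}`), «curved W nothing» in t4-ne3-formalise-ref INFO-42.  INTENT journal ≈16:41Z.  Pattern ADAPTED FROM
leaf-02-g5's `NE3CornerGaugeSpace` (p225712: `siteBump`, Gram form, Riesz vector) with `dPot ↦ gaugeDir W` and WITHOUT the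
block-sum clause; leaf-04's `NE3LandauOrbit.sum_hsR_gaugeDir` (covariant summation by parts) BY NAME.

CONTENT ([folklore]; 0 sorry; DATA defs `cornerGaugeSpace₀`, `gramW`; no `def … : Prop`):
§1 `covDiv_mem_skewAdjoint`; **`covDiv_eq_zero_offCorner_of_orthogonal`** — for unitary `(M·N)`-periodic `W` and skew periodic `Z`,
   `hsR`-orthogonality of `Z` to `gaugeDir W η` for every periodic, CORNER-TRIVIAL (`η (M•w) = 0`), 𝔲(n)-valued `η` forces
   `covDiv W Z (M•z + v) = 0` for `v ∈ [0,M)^d ∖ {0}` (one-site skew bumps);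
§2 `gaugeDir` algebra (`gaugeDir_add_pi`, `gaugeDir_smul_pi`), the ZERO-PROPAGATION lemma **`eq_zero_of_gaugeDir_eq_zero`** (a corner-trivial
   `η` with `gaugeDir W η = 0` vanishes: `η (x + e_μ) = Ad (W x μ)⁻¹ (η x)` walks the zero from the block corner to every site);
§3 the sub-module **`cornerGaugeSpace₀ P M`** (`P`-periodic, `η (M•w) = 0`, 𝔲(n)-valued), finite-dimensional;
§4 the Gram form **`gramW W P M`** of `gaugeDir W` over `periodBox P`, **`gramW_nondegenerate`** (unitary `P`-periodic `W`, `M ≥ 1`),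
   and **`exists_orthogonalW`** — for every `Y` an `η ∈ Ξ₀` with `Y + gaugeDir W η` `hsR`-orthogonal to `gaugeDir W ζ`, all `ζ ∈ Ξ₀`.
(File 2 `NE3CurvedProjectedLandau`: tangency by leaf-04's `tangentIter_add_gaugeDir_iff`, the representative in `T_pt(W)`, the
trivial intersection.)

HONEST FRAMING.  Linear algebra and lattice kinematics at ONE fixed background; nothing about Bałaban's minimisers; (P♮), (ML_w) at
W ≠ 1, T-E_w, (μK-FR), (ζ-def) and **NE3 are NOT proved**; spine PROVED 0∕9; finite T⁴ rung (B)+1 — NOT infinite volume, NOT mass gap,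
NOT `BetaPertH`, NOT Clay.  PLACEMENT: `Summits/QuantumFields/BalabanUV/`.  HONEST DEPENDENCY (cell page 1): continuum YM on T⁴ ⇐
BetaPertH ∧ nine spine estimates (0/9 proved); BetaPertH ⇐ (D1) ∧ (D4) ∧ CAP+tail; G-an2-4 gates asym, D1 and NE2/3/4.
-/

set_option autoImplicit false

open scoped BigOperators Matrix.Norms.L2Operator
open Finset

namespace Summit.QuantumFields.BalabanUV.T4Continuum.NE3CurvedCornerGaugeSpace

open Literature.MathematicalPhysics.QuantumFieldTheory.Balaban1983to89
open B7Prop1Explicit B7Prop2Explicit MatrixNorms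
open T4AveragingDeficitWall (IsSkewDir IsUnitaryCfg Ad)
open T4AveragingDeficitWallBoundary (periodBox mem_periodBox IsPeriodicCfg)
open AveragingDeficitPeriodicCounting (IsPeriodicDir)
open AveragingDeficitTransport (Ad_mem_skewAdjoint)
open AveragingDeficitNearIdentity (Ad_add Ad_zero Ad_real_smul)
open BlockAveragePushDirGauge (gaugeDir isPeriodicDir_gaugeDir)
open SkeletonLattice (cdiv cmod smul_cdiv_add_cmod cmod_nonneg)
open NE3CovariantCalculus (hsR hsR_add_left hsR_add_right hsR_self)
open NE3CovariantWeitzenbock (covDiv)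
open NE3LandauOrbit (eq_zero_of_nhsNormSq_eq_zero sum_hsR_gaugeDir covDiv_add_period)
open NE3FrameFreeDecompositionPrep (hsR_smul_left hsR_smul_right)
open PeriodicChoice (apply_wrap_eq wrap_mem_periodBox)
open NE3CornerGaugeSpace (siteBump siteBump_add_period siteBump_mem_skewAdjoint sum_hsR_siteBump siteBump_corner)

noncomputable section

variable {d : ℕ} {n : Type*} [Fintype n] [DecidableEq n]

/-! ## §1 Orthogonality to the corner-trivial gauge directions forces a vanishing covariant divergence off the corners -/

/-- The covariant divergence of a 𝔲(n)-valued direction at a unitary background is 𝔲(n)-valued. [folklore] -/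
theorem covDiv_mem_skewAdjoint {W : Site d → Fin d → (Matrix n n ℂ)ˣ} (hWu : IsUnitaryCfg W)
    {Z : Site d → Fin d → Matrix n n ℂ} (hZs : IsSkewDir Z) (x : Site d) : covDiv W Z x ∈ skewAdjoint (Matrix n n ℂ) := by
  unfold covDiv
  exact (skewAdjoint _).sum_mem fun μ _ => (skewAdjoint _).sub_mem (Ad_mem_skewAdjoint (hWu x μ) (hZs x μ)) (hZs _ μ)

/-- **ORTHOGONAL TO `D_W Ξ₀` ⇒ COVARIANT DIVERGENCE ZERO OFF THE CORNERS.**  `M, N ≥ 1`; `W` unitary and `(M·N)`-periodic; `Z` skew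
and `(M·N)`-periodic with `Σ_{x∈periodBox (M·N)} Σ_μ hsR (Z x μ) (gaugeDir W η x μ) = 0` for every `(M·N)`-periodic, corner-trivial,
𝔲(n)-valued site field `η`.  Then `covDiv W Z (M•z + v) = 0` for every block `z` and `v ∈ [0,M)^d ∖ {0}` (test with the one-site
skew bump at `M•z + v` carrying `covDiv W Z (M•z + v)`). [folklore] -/
theorem covDiv_eq_zero_offCorner_of_orthogonal {M N : ℕ} (hM : 1 ≤ M) (hN : 1 ≤ N) {W : Site d → Fin d → (Matrix n n ℂ)ˣ}
    (hWu : IsUnitaryCfg W) (hWP : IsPeriodicCfg W ((M * N : ℕ) : ℤ)) {Z : Site d → Fin d → Matrix n n ℂ} (hZs : IsSkewDir Z)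
    (hZP : IsPeriodicDir Z ((M * N : ℕ) : ℤ))
    (horth : ∀ η : Site d → Matrix n n ℂ, (∀ (x : Site d) (κ : Fin d), η (x + ((M * N : ℕ) : ℤ) • e κ) = η x) →
      (∀ w : Site d, η ((M : ℤ) • w) = 0) → (∀ x : Site d, η x ∈ skewAdjoint (Matrix n n ℂ)) →
      ∑ x ∈ periodBox (d := d) (M * N), ∑ μ : Fin d, hsR (Z x μ) (gaugeDir W η x μ) = 0) :
    ∀ (z v : Site d), v ∈ periodBox (d := d) M → v ≠ 0 → covDiv W Z ((M : ℤ) • z + v) = 0 := by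
  have hP : 1 ≤ M * N := Nat.one_le_iff_ne_zero.mpr (Nat.mul_ne_zero (by omega) (by omega))
  intro z v hv hv0
  set S : Matrix n n ℂ := covDiv W Z ((M : ℤ) • z + v) with hS_def
  have hS : S ∈ skewAdjoint (Matrix n n ℂ) := covDiv_mem_skewAdjoint hWu hZs _
  set η : Site d → Matrix n n ℂ := siteBump (M * N) ((M : ℤ) • z + v) S with hη_def
  have hηP : ∀ (x : Site d) (κ : Fin d), η (x + ((M * N : ℕ) : ℤ) • e κ) = η x := fun x κ => by
    simp only [hη_def, siteBump_add_period]
  have hη0 : ∀ w : Site d, η ((M : ℤ) • w) = 0 := fun w => by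
    simp only [hη_def, siteBump_corner hM N z w hv hv0]
  have hηs : ∀ x : Site d, η x ∈ skewAdjoint (Matrix n n ℂ) := fun x => siteBump_mem_skewAdjoint _ _ hS _
  have h := horth η hηP hη0 hηs
  have hDP : ∀ (x : Site d) (τ : Fin d), covDiv W Z (x + ((M * N : ℕ) : ℤ) • e τ) = covDiv W Z x := covDiv_add_period hWP hZP
  rw [sum_hsR_gaugeDir hP hWu hZP hηP] at h
  simp only [hη_def, sum_hsR_siteBump hP] at h
  rw [apply_wrap_eq (g := covDiv W Z) hDP, ← hS_def, hsR_self] at h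
  exact eq_zero_of_nhsNormSq_eq_zero h

/-! ## §2 `gaugeDir` algebra and the propagation of zeros -/

/-- `gaugeDir` is additive in the generator (Pi form). [folklore] -/
theorem gaugeDir_add_pi (W : Site d → Fin d → (Matrix n n ℂ)ˣ) (Φ Ψ : Site d → Matrix n n ℂ) (x : Site d) (μ : Fin d) :
    gaugeDir W (Φ + Ψ) x μ = gaugeDir W Φ x μ + gaugeDir W Ψ x μ := by
  simp only [gaugeDir, Pi.add_apply, Ad_add]
  abel

/-- `gaugeDir` commutes with real scalars (Pi form). [folklore] -/
theorem gaugeDir_smul_pi (W : Site d → Fin d → (Matrix n n ℂ)ˣ) (t : ℝ) (Φ : Site d → Matrix n n ℂ) (x : Site d) (μ : Fin d) :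
    gaugeDir W (t • Φ) x μ = t • gaugeDir W Φ x μ := by
  simp only [gaugeDir, Pi.smul_apply, Ad_real_smul, smul_sub]

/-- One forward step: if `gaugeDir W η x μ = 0` and `η x = 0` then `η (x + e_μ) = 0`. [folklore] -/
theorem step_zero {W : Site d → Fin d → (Matrix n n ℂ)ˣ} {η : Site d → Matrix n n ℂ} {x : Site d} {μ : Fin d}
    (hg : gaugeDir W η x μ = 0) (hx : η x = 0) : η (x + e μ) = 0 := by
  have h : Ad (W x μ)⁻¹ (η x) - η (x + e μ) = 0 := hg
  rw [hx, Ad_zero, zero_sub, neg_eq_zero] at h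
  exact h

/-- Walking the zero along non-negative offsets: if `gaugeDir W η = 0` identically and `η x = 0`, then `η (x + v) = 0` for every
`v ≥ 0` (induction on `Σ_i v_i`). [folklore] -/
theorem walk_zero {W : Site d → Fin d → (Matrix n n ℂ)ˣ} {η : Site d → Matrix n n ℂ} (hg : ∀ (x : Site d) (μ : Fin d), gaugeDir W η x μ = 0) :
    ∀ (m : ℕ) (x v : Site d), (∀ i, 0 ≤ v i) → ∑ i, v i = (m : ℤ) → η x = 0 → η (x + v) = 0 := by
  intro m
  induction m with
  | zero =>
    intro x v hv hsum hx
    have hv0 : v = 0 := by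
      funext i
      have := (Finset.sum_eq_zero_iff_of_nonneg fun j _ => hv j).1 (by exact_mod_cast hsum) i (Finset.mem_univ i)
      simpa using this
    rw [hv0, add_zero]; exact hx
  | succ m ih =>
    intro x v hv hsum hx
    -- some coordinate is positive
    have hex : ∃ i, 0 < v i := by
      by_contra hne
      simp only [not_exists, not_lt] at hne
      have hall : ∀ i, v i = 0 := fun i => le_antisymm (hne i) (hv i)
      have : ∑ i, v i = 0 := Finset.sum_eq_zero fun i _ => hall i
      rw [this] at hsum
      exact absurd hsum (by push_cast; omega)
    obtain ⟨i, hi⟩ := hex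
    set v' : Site d := v - e i with hv'
    have hv'nn : ∀ j, 0 ≤ v' j := by
      intro j
      simp only [hv', Pi.sub_apply, e_apply]
      split_ifs with h
      · subst h; omega
      · linarith [hv j]
    have hsum' : ∑ j, v' j = (m : ℤ) := by
      have h1 : ∑ j, v' j = ∑ j, v j - ∑ j : Fin d, e i j := by
        simp only [hv', Pi.sub_apply, Finset.sum_sub_distrib]
      have h2 : ∑ j : Fin d, e i j = 1 := by
        simp only [e_apply, Finset.sum_ite_eq', Finset.mem_univ, if_true]
      rw [h1, h2, hsum]; push_cast; ring
    have hstep := ih x v' hv'nn hsum' hx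
    have hxv : x + v = (x + v') + e i := by rw [hv']; abel
    rw [hxv]
    exact step_zero (hg _ _) hstep

/-- **A CORNER-TRIVIAL GENERATOR WITH VANISHING GAUGE DIRECTION VANISHES** (`M ≥ 1`): `gaugeDir W η = 0` and `η (M•w) = 0` for
all `w` give `η = 0` — every site is its block corner plus a non-negative offset. [folklore] -/
theorem eq_zero_of_gaugeDir_eq_zero {M : ℕ} (hM : 1 ≤ M) {W : Site d → Fin d → (Matrix n n ℂ)ˣ} {η : Site d → Matrix n n ℂ}
    (hg : ∀ (x : Site d) (μ : Fin d), gaugeDir W η x μ = 0) (h0 : ∀ w : Site d, η ((M : ℤ) • w) = 0) : η = 0 := by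
  funext y
  have hy : (M : ℤ) • cdiv M y + cmod M y = y := smul_cdiv_add_cmod (L := M) y
  have hnn : ∀ i, 0 ≤ cmod M y i := fun i => cmod_nonneg (L := M) hM y i
  have hsum : ∑ i, cmod M y i = ((∑ i, cmod M y i).toNat : ℤ) :=
    (Int.toNat_of_nonneg (Finset.sum_nonneg fun i _ => hnn i)).symm
  rw [← hy]
  exact walk_zero hg _ _ _ hnn hsum (h0 _)

/-! ## §3 The corner gauge space `Ξ₀(P, M)`; finite-dimensionality -/

/-- THE CORNER-TRIVIAL GAUGE SPACE `Ξ₀(P, M)`: the `ℝ`-submodule of `P`-periodic, corner-trivial (`η (M•w) = 0`), 𝔲(n)-valued site fields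
(no block-mean condition — the complement of the PROJECTED-LANDAU slice; ADAPTED from leaf-02-g5's `cornerGaugeSpace`). [folklore] -/
def cornerGaugeSpace₀ (P M : ℕ) : Submodule ℝ (Site d → Matrix n n ℂ) where
  carrier := {ξ | (∀ (x : Site d) (κ : Fin d), ξ (x + (P : ℤ) • e κ) = ξ x) ∧ (∀ w : Site d, ξ ((M : ℤ) • w) = 0)
    ∧ ∀ x : Site d, ξ x ∈ skewAdjoint (Matrix n n ℂ)}
  zero_mem' := ⟨fun _ _ => rfl, fun _ => rfl, fun _ => (skewAdjoint _).zero_mem⟩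
  add_mem' := by
    rintro ξ ζ ⟨hξP, hξ0, hξs⟩ ⟨hζP, hζ0, hζs⟩
    refine ⟨fun x κ => ?_, fun w => ?_, fun x => ?_⟩
    · simp only [Pi.add_apply, hξP, hζP]
    · simp only [Pi.add_apply, hξ0, hζ0, add_zero]
    · exact (skewAdjoint _).add_mem (hξs x) (hζs x)
  smul_mem' := by
    rintro t ξ ⟨hξP, hξ0, hξs⟩
    refine ⟨fun x κ => ?_, fun w => ?_, fun x => ?_⟩
    · simp only [Pi.smul_apply, hξP]
    · simp only [Pi.smul_apply, hξ0, smul_zero]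
    · exact skewAdjoint.smul_mem t (hξs x)

omit [Fintype n] [DecidableEq n] in
/-- Membership in `Ξ₀(P, M)`, unfolded. [folklore] -/
theorem mem_cornerGaugeSpace₀_iff {P M : ℕ} {ξ : Site d → Matrix n n ℂ} :
    ξ ∈ cornerGaugeSpace₀ (d := d) (n := n) P M ↔ (∀ (x : Site d) (κ : Fin d), ξ (x + (P : ℤ) • e κ) = ξ x)
      ∧ (∀ w : Site d, ξ ((M : ℤ) • w) = 0) ∧ ∀ x : Site d, ξ x ∈ skewAdjoint (Matrix n n ℂ) :=
  Iff.rfl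

omit [DecidableEq n] in
/-- `Ξ₀(P, M)` is finite-dimensional (`P ≥ 1`): restriction to the period box is injective (ADAPTED from leaf-02-g5). [folklore] -/
theorem finiteDimensional_cornerGaugeSpace₀ {P : ℕ} (hP : 1 ≤ P) (M : ℕ) :
    FiniteDimensional ℝ (cornerGaugeSpace₀ (d := d) (n := n) P M) := by
  let res : cornerGaugeSpace₀ (d := d) (n := n) P M →ₗ[ℝ] (↥(periodBox (d := d) P) → Matrix n n ℂ) :=
    { toFun := fun ξ x => (ξ : Site d → Matrix n n ℂ) x.1
      map_add' := fun _ _ => rfl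
      map_smul' := fun _ _ => rfl }
  refine FiniteDimensional.of_injective res fun ξ ζ h => ?_
  apply Subtype.ext
  funext x
  have hξ := apply_wrap_eq (mem_cornerGaugeSpace₀_iff.mp ξ.2).1 x
  have hζ := apply_wrap_eq (mem_cornerGaugeSpace₀_iff.mp ζ.2).1 x
  rw [← hξ, ← hζ]
  exact congr_fun h ⟨_, wrap_mem_periodBox P hP x⟩

/-! ## §4 The Gram form of `gaugeDir W` on `Ξ₀`; nondegeneracy; the projection step -/

/-- THE GRAM FORM OF `D_W` OVER THE PERIOD BOX: `gramW W P M η ζ = Σ_{x∈periodBox P} Σ_μ hsR (gaugeDir W η x μ) (gaugeDir W ζ x μ)`. [folklore] -/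
def gramW (W : Site d → Fin d → (Matrix n n ℂ)ˣ) (P M : ℕ) : LinearMap.BilinForm ℝ (cornerGaugeSpace₀ (d := d) (n := n) P M) :=
  LinearMap.mk₂ ℝ
    (fun η ζ => ∑ x ∈ periodBox (d := d) P, ∑ μ : Fin d,
      hsR (gaugeDir W (η : Site d → Matrix n n ℂ) x μ) (gaugeDir W (ζ : Site d → Matrix n n ℂ) x μ))
    (fun η η' ζ => by
      simp only [Submodule.coe_add, gaugeDir_add_pi, hsR_add_left, Finset.sum_add_distrib])
    (fun t η ζ => by
      simp only [Submodule.coe_smul, gaugeDir_smul_pi, hsR_smul_left, Finset.mul_sum, smul_eq_mul])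
    (fun η ζ ζ' => by
      simp only [Submodule.coe_add, gaugeDir_add_pi, hsR_add_right, Finset.sum_add_distrib])
    (fun t η ζ => by
      simp only [Submodule.coe_smul, gaugeDir_smul_pi, hsR_smul_right, Finset.mul_sum, smul_eq_mul])

/-- `gramW` unfolded. [folklore] -/
theorem gramW_apply (W : Site d → Fin d → (Matrix n n ℂ)ˣ) (P M : ℕ) (η ζ : cornerGaugeSpace₀ (d := d) (n := n) P M) :
    gramW W P M η ζ = ∑ x ∈ periodBox (d := d) P, ∑ μ : Fin d,
      hsR (gaugeDir W (η : Site d → Matrix n n ℂ) x μ) (gaugeDir W (ζ : Site d → Matrix n n ℂ) x μ) :=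
  rfl

/-- **THE GRAM FORM OF `D_W` IS NONDEGENERATE ON `Ξ₀(P, M)`** (`P, M ≥ 1`, `W` `P`-periodic): `gramW η η = Σ nhsNormSq (gaugeDir W η) = 0`
forces `gaugeDir W η = 0` on the period box, hence everywhere, hence `η = 0` by the corner condition (`eq_zero_of_gaugeDir_eq_zero`).
[folklore] -/
theorem gramW_nondegenerate {P M : ℕ} (hP : 1 ≤ P) (hM : 1 ≤ M) {W : Site d → Fin d → (Matrix n n ℂ)ˣ}
    (hWP : IsPeriodicCfg W (P : ℤ)) : (gramW (d := d) (n := n) W P M).Nondegenerate := by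
  have key : ∀ η : cornerGaugeSpace₀ (d := d) (n := n) P M, gramW W P M η η = 0 → η = 0 := by
    intro η h
    rw [gramW_apply] at h
    simp only [hsR_self] at h
    obtain ⟨hηP, hη0, -⟩ := mem_cornerGaugeSpace₀_iff.mp η.2
    have hbox : ∀ x ∈ periodBox (d := d) P, ∀ μ : Fin d, gaugeDir W (η : Site d → Matrix n n ℂ) x μ = 0 := by
      intro x hx μ
      have h1 := (Finset.sum_eq_zero_iff_of_nonneg fun y _ =>
        Finset.sum_nonneg fun ν _ => nhsNormSq_nonneg (gaugeDir W (η : Site d → Matrix n n ℂ) y ν)).1 h x hx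
      have h2 := (Finset.sum_eq_zero_iff_of_nonneg fun ν _ =>
        nhsNormSq_nonneg (gaugeDir W (η : Site d → Matrix n n ℂ) x ν)).1 h1 μ (Finset.mem_univ μ)
      exact eq_zero_of_nhsNormSq_eq_zero h2
    have hper := isPeriodicDir_gaugeDir hWP hηP
    have hall : ∀ (x : Site d) (μ : Fin d), gaugeDir W (η : Site d → Matrix n n ℂ) x μ = 0 := by
      intro x μ
      have hw := apply_wrap_eq (g := fun y => gaugeDir W (η : Site d → Matrix n n ℂ) y μ) (fun y κ => hper y κ μ) x
      rw [← hw]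
      exact hbox _ (wrap_mem_periodBox P hP x) μ
    exact Subtype.ext (eq_zero_of_gaugeDir_eq_zero hM hall hη0)
  exact ⟨fun η hη => key η (hη η), fun η hη => key η (hη η)⟩

/-- **THE PROJECTION STEP AT A CURVED BACKGROUND** (`P, M ≥ 1`, `W` `P`-periodic): for every direction field `Y` there is
`η ∈ Ξ₀(P, M)` with `Y + gaugeDir W η` `hsR`-orthogonal over the period box to `gaugeDir W ζ` for every `ζ ∈ Ξ₀(P, M)` — the Riesz
vector of `ζ ↦ −Σ hsR Y (gaugeDir W ζ)` for the nondegenerate `gramW` (ADAPTED from leaf-02-g5's `exists_orthogonal`). [folklore] -/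
theorem exists_orthogonalW {P M : ℕ} (hP : 1 ≤ P) (hM : 1 ≤ M) {W : Site d → Fin d → (Matrix n n ℂ)ˣ}
    (hWP : IsPeriodicCfg W (P : ℤ)) (Y : Site d → Fin d → Matrix n n ℂ) :
    ∃ η ∈ cornerGaugeSpace₀ (d := d) (n := n) P M, ∀ ζ ∈ cornerGaugeSpace₀ (d := d) (n := n) P M,
      ∑ x ∈ periodBox (d := d) P, ∑ μ : Fin d, hsR (Y x μ + gaugeDir W η x μ) (gaugeDir W ζ x μ) = 0 := by
  haveI := finiteDimensional_cornerGaugeSpace₀ (d := d) (n := n) hP M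
  let ℓ : Module.Dual ℝ (cornerGaugeSpace₀ (d := d) (n := n) P M) :=
    { toFun := fun ζ => -∑ x ∈ periodBox (d := d) P, ∑ μ : Fin d, hsR (Y x μ) (gaugeDir W (ζ : Site d → Matrix n n ℂ) x μ)
      map_add' := fun ζ ζ' => by
        simp only [Submodule.coe_add, gaugeDir_add_pi, hsR_add_right, Finset.sum_add_distrib, neg_add]
      map_smul' := fun t ζ => by
        simp only [Submodule.coe_smul, gaugeDir_smul_pi, hsR_smul_right, Finset.mul_sum, RingHom.id_apply, smul_eq_mul,
          mul_neg] }
  set η := ((gramW (d := d) (n := n) W P M).toDual (gramW_nondegenerate hP hM hWP)).symm ℓ with hη_def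
  refine ⟨η, η.2, fun ζ hζ => ?_⟩
  have h := LinearMap.BilinForm.apply_toDual_symm_apply (hB := gramW_nondegenerate (d := d) (n := n) (M := M) hP hM hWP) ℓ ⟨ζ, hζ⟩
  rw [← hη_def, gramW_apply] at h
  have hℓ : ℓ ⟨ζ, hζ⟩ = -∑ x ∈ periodBox (d := d) P, ∑ μ : Fin d, hsR (Y x μ) (gaugeDir W ζ x μ) := rfl
  rw [hℓ] at h
  simp only [hsR_add_left, Finset.sum_add_distrib]
  linarith

end

end Summit.QuantumFields.BalabanUV.T4Continuum.NE3CurvedCornerGaugeSpace
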